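import Summits.BirchSwinnertonDyer.Rank1Residual.F1Sign2.SquareLawAtTwo
import HarnessLib

/-!
# KS4 — the square law for Kurihara numbers at two BEYOND the Kolyvagin depth («K2-F♯-wide»)
(cell bsd-f1-sign2, seat -es g38, bonus-2; crux `ByReductionTypeAtTwo.RankOneAtTwoBigImageOddLocal`
= stmt-BirchSwinnertonDyer-23715; data record `Cruxes/RankOneAtTwoBigImageOddLocal/CensusKS4.md`
v1.2, kit j343995 `KS4-es-g38` + re-check j344091 + windows j344119 `KS5-es-g38`, j344245 `KS6m1-es-g38`; MEMO-es §47.9–§47.10.)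

K2-F♯ = `F1Sign2.AnalyticSquareLawAtTwo` (seat g3; DES9–11: 46 298 level checks, 3 787 uncensored,
0 exceptions) states `v₂(δ'_k(ℓ;ψ) mod 2^k) = min(k, s + 1 + 2·d_ℓ(P))` for level-`k` `τ`-primes in
KOLYVAGIN'S sense: `2^k ∣ ℓ − 1` AND `2^k ∣ a_ℓ − 2`.  The character `ψ : (ℤ/ℓ)ˣ ↠ ℤ/2^k` only needs
`2^k ∣ ℓ − 1`; KS4 evaluated the same sums at `k = K := v₂(ℓ − 1) > m := v₂ #Ẽ(𝔽_ℓ)` (so `2^k ∤ a_ℓ − 2`: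
outside Kurihara's `𝒫^{(k)}`, no Kolyvagin derivative class at level `k`) on 115 rank-one curves
(`s ∈ {0, 2, 4}`) × 110 deep transposition primes `ℓ ≤ 2969`, 3 211 rows, and found (Tamagawa-odd curves,
tolerance zero; `d = d_ℓ(P)` from a `2`-saturated generator, two engines for `d`):
* for `2d ≤ m` the law holds VERBATIM beyond the depth: **1 043/1 043 uncensored** rows there
  (1 473/1 473 distinct uncensored rows including the Kolyvagin range; 2 125 level checks DES10-style), among them the FIRST uncensored `s = 4` rows of the cell
  (8/8: `v₂ δ' = 5` on the four `Ш_an[2^∞] = (ℤ/4)²` slice curves at `ℓ ≡ 1 (64)`);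
* for `2d > m` or `d = ∞` (`P ∈ 2^j E(ℚ_ℓ)` for all `j`) the numbers are NOT censored-to-infinity:
  `2^{min(k, s + m + 2)} ∣ δ'_k` on **389/389** rows, the floor attained on 39 of the 74 decidable rows and
  the value NOT a function of `(ℓ, s, m)` (a global — Mazur–Tate-regulator — input decides it).
WINDOW TEST KS5 (kit j344119, after typing; same curves, `ℓ ≡ 1 (64)`, `3000 ≤ ℓ < 10⁵`, `k = K ≤ 12`,
8 210 rows, 0 errors): clause (1) **6 065/6 065 uncensored rows exact** (145 of them at `s = 4`; 69 distinct
`(s,m,d)` cells, `m ≤ 14`, `d ≤ 3`), clause (2) **1 690 rows, 0 below the floor**, floor attained on 542 of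
the 1 100 decidable rows (49 %; finite-`d` sub-regime 84/175, `d = ∞` 458/925) — so (2) is sharp as a
divisibility and not an equality in `(s, m, d)`; Tamagawa-even controls violate (1) on 205/251 rows.
WINDOW TEST KS6 (kit j344245; the `m = 1` regime `a_ℓ ≡ 0 (4)`, where K2-F♯ speaks only at `k = 1`:
`ℓ ≡ 1 (32)`, `10³ ≤ ℓ < 5·10⁴`, `K ≤ 12`; 9 192 rows, 0 errors): clause (1) (`d = 0`: `v₂ δ'_K = s + 1`)
**4 326/4 326 uncensored rows exact** (77 at `s = 4`), clause (2) (`d = ∞`: `2^{min(K,s+3)} ∣ δ'_K`)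
**4 461 rows, 0 below**, floor attained 1 723/3 525 = 49 %.
`AnalyticSquareLawAtTwoWide` below types exactly this two-clause law (analytic form, `s := v₂ #Ш_an`, as
K2-F♯'s data form) at EVERY `τ`-prime (v2: the v1 regime binder `4 ∣ a_ℓ − 2` was dropped after KS6;
`m ≥ 1`); `m` is bound by exact divisibility (`2^m ∥ ℓ + 1 − a_ℓ`), no `padicVal` junk value.  Inside the Kolyvagin range `k ≤ m` the two
clauses say the same thing as K2-F♯, which is the kernel-checked glue `analyticSquareLaw_of_wide` (K2-F♯'s
conclusion at every Kolyvagin prime, from the wide law; the only arithmetic input is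
`k ≤ m`, i.e. `2^k ∣ (ℓ − 1) − (a_ℓ − 2)`).
Why it might fail: the second clause is an empirical FLOOR (2 079 rows, `ℓ < 10⁵`, `k ≤ 12`); a
universal-norm generator (`d = ∞`) at a prime with small Mazur–Tate local height could undershoot
`s + m + 2`; the first clause beyond the depth rests on 6 874 uncensored rows with `m ≤ 14`, `d ≤ 3`.
Cheapest falsifier: any Tamagawa-odd row violating either clause in a re-run of `ks5.py` on another window
(`ℓ ≡ 1 (2^K)` for larger `K`, or curves with `s ≥ 6`), or a curve where clause (2) is strict at EVERY prime.
Sources: Mazur–Tate, Duke 54 (1987) Conj. 4 [cite: MazurTate1987, Conj. 4]; Bertolini–Darmon, Duke 76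
(1994) §2.3–2.5 (derived heights) [cite: BertoliniDarmon1994, Conj. 4.6]; Kurihara arXiv:1407.2465 §1.2
[cite: Kurihara2014, Conj. 1.2.4]; K2-F♯ docstring (this tree).  Literature placement: asked (INBOX
T-es-KS4); seat's corpus + galaxy searches found no printed statement at any `p` (NOTES presearch).
-/

noncomputable section

open scoped Classical MatrixGroups ModularForm

open CongruenceSubgroup WeierstrassCurve Literature.NumberTheory.EllipticCurves
  Literature.NumberTheory.EllipticCurves.ModularForms
open Summit.BirchSwinnertonDyer.Rank1Residual.F1Sign2

namespace Summit.BirchSwinnertonDyer.BirchSwinnertonDyer.Cruxes.RankOneAtTwoBigImageOddLocal.KS4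

/-- **KS4-W `AnalyticSquareLawAtTwoWide` (candidate crux; conjecture, NEW second clause and new range):
the square law at two beyond the Kolyvagin depth.**  Setting of `F1Sign2.AnalyticSquareLawAtTwo`
(globally minimal `E/ℚ`, newform `f` with the period transfer at `2`, `ρ_{E,2^∞}` onto, odd torsion, odd
Tamagawa product, `w = −1`, analytic rank `1`, `#Ш_an = q ≠ 0`, `s := v₂ q`, `P ∈ E(ℚ)` of infinite
order with `P ∉ 2E(ℚ)`), `ℓ` a `τ`-prime (`IsLevelAtTwo`), `2^k ∣ ℓ − 1` (ANY such `k ≥ 1` — no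
condition `2^k ∣ a_ℓ − 2`), `2^m ∥ ℓ + 1 − a_ℓ` (`= v₂ #Ẽ(𝔽_ℓ)`, the `2`-Sylow being cyclic),
`ψ : (ℤ/ℓ)ˣ ↠ ℤ/2^k`.  CLAIM, for every `j`:
(1) if `2j ≤ m`: `P ∈ 2^j E(ℚ_ℓ) ⟹ δ'_k ∈ 2^{min(k, s+1+2j)} ℤ_{(2)}` and
    `P ∉ 2^{j+1} E(ℚ_ℓ), s + 2 + 2j ≤ k ⟹ δ'_k ∉ 2^{s+2+2j} ℤ_{(2)}` (K2-F♯'s two conjuncts verbatim);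
(2) if `m < 2j`: `P ∈ 2^j E(ℚ_ℓ) ⟹ δ'_k ∈ 2^{min(k, s+m+2)} ℤ_{(2)}`.
Data: CensusKS4 §2.3/§2.5/§2.6 (clause 1: 1 473 + 6 065 + 4 326 = 11 864 distinct uncensored rows exact, 0 exceptions,
all censored rows consistent; clause 2: 389 + 1 690 + 4 461 rows, 0 below, floor attained 49 % of decidable rows; Tamagawa-even controls violate clause 1 twice in 115 — the `Odd W.tamagawaProduct`
binder is load-bearing). -/
@[conjecture] def AnalyticSquareLawAtTwoWide : Prop :=
  ∀ (W : WeierstrassCurve ℚ) [W.IsElliptic] [W.IsGloballyMinimal] {M : ℕ} [NeZero M]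
    (f : CuspForm (Gamma0 M) 2), IsNewformOf W f → PeriodTransferAtTwo W f →
    (∀ n : ℕ, W.HasSurjectiveModNGaloisRep ((2 ^ n : ℕ) : ℤ)) → Odd W.torsionOrder → Odd W.tamagawaProduct →
    W.rootNumber = -1 → W.analyticRank = 1 →
    ∀ q : ℚ, shaAn W = (q : ℂ) → q ≠ 0 →
    ∀ P : (W.toAffine.baseChange ℚ).Point, (∀ n : ℕ, n ≠ 0 → n • P ≠ 0) →
      (∀ Q : (W.toAffine.baseChange ℚ).Point, 2 • Q ≠ P) →
    let s := (padicValRat 2 q).toNat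
    ∀ (ℓ k m j : ℕ) [Fact ℓ.Prime], IsLevelAtTwo W ℓ → 1 ≤ k → (2 ^ k : ℤ) ∣ (ℓ : ℤ) - 1 →
      (2 ^ m : ℤ) ∣ (ℓ : ℤ) + 1 - W.frobeniusTrace ℓ → ¬ (2 ^ (m + 1) : ℤ) ∣ (ℓ : ℤ) + 1 - W.frobeniusTrace ℓ →
      ∀ ψ : (ZMod ℓ)ˣ →* Multiplicative (ZMod (2 ^ k)), Function.Surjective ψ →
        (2 * j ≤ m →
          (LocallyTwoPowDivisible W ℓ j P → InTwoPowZLoc (min k (s + 1 + 2 * j)) (levelSumTwo f ℓ k ψ)) ∧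
          (¬ LocallyTwoPowDivisible W ℓ (j + 1) P → s + 2 + 2 * j ≤ k →
            ¬ InTwoPowZLoc (s + 2 + 2 * j) (levelSumTwo f ℓ k ψ))) ∧
        (m < 2 * j → LocallyTwoPowDivisible W ℓ j P →
          InTwoPowZLoc (min k (s + m + 2)) (levelSumTwo f ℓ k ψ))

/-- Exact `2`-adic valuation as a pair of divisibilities: for `x ≠ 0`, `m := v₂ x` satisfies
`2^m ∣ x` and `2^{m+1} ∤ x`. -/
theorem exists_exact_two_pow_dvd (x : ℤ) (hx : x ≠ 0) :
    ∃ m : ℕ, (2 ^ m : ℤ) ∣ x ∧ ¬ (2 ^ (m + 1) : ℤ) ∣ x := by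
  refine ⟨padicValInt 2 x, ?_, ?_⟩
  · exact (padicValInt_dvd_iff (p := 2) _ x).mpr (Or.inr le_rfl)
  · intro h
    rcases (padicValInt_dvd_iff (p := 2) _ x).mp h with h0 | hle
    · exact hx h0
    · omega

/-- `2^k ∣ x ≠ 0` and `2^m ∥ x` give `k ≤ m`. -/
theorem le_of_two_pow_dvd_of_exact {x : ℤ} {k m : ℕ} (hk : (2 ^ k : ℤ) ∣ x)
    (hm' : ¬ (2 ^ (m + 1) : ℤ) ∣ x) : k ≤ m := by
  by_contra h
  have hmk : m + 1 ≤ k := by omega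
  exact hm' (dvd_trans (pow_dvd_pow 2 hmk) hk)

/-- **Glue (kernel-checked): inside the Kolyvagin range the wide law IS K2-F♯.**  At a Kolyvagin prime of
level `k` (`2^k ∣ ℓ − 1` and `2^k ∣ a_ℓ − 2`) with `#Ẽ(𝔽_ℓ) ≠ 0` as an integer
(`ℓ + 1 − a_ℓ ≠ 0`, Hasse), `AnalyticSquareLawAtTwoWide` yields the conclusion of
`F1Sign2.AnalyticSquareLawAtTwo` for every `j`: one has `k ≤ m`, so for `2j ≤ m` clause (1) is it, and for
`m < 2j` clause (2) gives `δ' ∈ 2^k ℤ_{(2)} ⊆ 2^{min(k, s+1+2j)} ℤ_{(2)}` while the non-divisibility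
conjunct is vacuous (`s + 2 + 2j ≤ k ≤ m < 2j` is absurd). -/
theorem analyticSquareLaw_of_wide (hW : AnalyticSquareLawAtTwoWide)
    (W : WeierstrassCurve ℚ) [W.IsElliptic] [W.IsGloballyMinimal] {M : ℕ} [NeZero M]
    (f : CuspForm (Gamma0 M) 2) (hf : IsNewformOf W f) (hper : PeriodTransferAtTwo W f)
    (hsurj : ∀ n : ℕ, W.HasSurjectiveModNGaloisRep ((2 ^ n : ℕ) : ℤ)) (hT : Odd W.torsionOrder)
    (hc : Odd W.tamagawaProduct) (hw : W.rootNumber = -1) (hr : W.analyticRank = 1)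
    (q : ℚ) (hq : shaAn W = (q : ℂ)) (hq0 : q ≠ 0)
    (P : (W.toAffine.baseChange ℚ).Point) (hP1 : ∀ n : ℕ, n ≠ 0 → n • P ≠ 0)
    (hP2 : ∀ Q : (W.toAffine.baseChange ℚ).Point, 2 • Q ≠ P)
    (ℓ k j : ℕ) [Fact ℓ.Prime] (hlev : IsLevelAtTwo W ℓ) (hk : 1 ≤ k) (hl : (2 ^ k : ℤ) ∣ (ℓ : ℤ) - 1)
    (ha : (2 ^ k : ℤ) ∣ W.frobeniusTrace ℓ - 2)
    (hne : (ℓ : ℤ) + 1 - W.frobeniusTrace ℓ ≠ 0)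
    (ψ : (ZMod ℓ)ˣ →* Multiplicative (ZMod (2 ^ k))) (hψ : Function.Surjective ψ) :
    (LocallyTwoPowDivisible W ℓ j P →
        InTwoPowZLoc (min k ((padicValRat 2 q).toNat + 1 + 2 * j)) (levelSumTwo f ℓ k ψ)) ∧
      (¬ LocallyTwoPowDivisible W ℓ (j + 1) P → (padicValRat 2 q).toNat + 2 + 2 * j ≤ k →
        ¬ InTwoPowZLoc ((padicValRat 2 q).toNat + 2 + 2 * j) (levelSumTwo f ℓ k ψ)) := by
  obtain ⟨m, hm, hm'⟩ := exists_exact_two_pow_dvd _ hne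
  have hkx : (2 ^ k : ℤ) ∣ (ℓ : ℤ) + 1 - W.frobeniusTrace ℓ := by
    have := dvd_sub hl ha
    have e : (ℓ : ℤ) - 1 - (W.frobeniusTrace ℓ - 2) = (ℓ : ℤ) + 1 - W.frobeniusTrace ℓ := by ring
    rw [e] at this; exact this
  have hkm : k ≤ m := le_of_two_pow_dvd_of_exact hkx hm'
  have h := hW W f hf hper hsurj hT hc hw hr q hq hq0 P hP1 hP2 ℓ k m j hlev hk hl hm hm' ψ hψ
  by_cases hjm : 2 * j ≤ m
  · exact h.1 hjm
  · have hmj : m < 2 * j := by omega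
    refine ⟨fun hdiv => ?_, fun _ hsk => ?_⟩
    · have h2 := h.2 hmj hdiv
      rw [min_eq_left (by omega : k ≤ (padicValRat 2 q).toNat + m + 2)] at h2
      exact inTwoPowZLoc_mono (min_le_left _ _) h2
    · exfalso; omega

end Summit.BirchSwinnertonDyer.BirchSwinnertonDyer.Cruxes.RankOneAtTwoBigImageOddLocal.KS4

end
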